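import Mathlib
import Summits.KontsevichZagierPeriods.Zeta5Search.BrickFrobeniusTwoOddRow

/-!
# BrickFrobeniusTwoOddRowEven — «(B1)» at the prime `2` on an ODD row, EVEN poles: the Laurent cells of the centre-free brick
kernel at the pole `2K` of the row `2N+1` against the cells at the pole `K` of the row `N`:
`2^d·laurent(2N+1, 2K, d) = 2^B·Σ_{m+e=d} w′_m·laurent(N, K, e)`, `w′_m ∈ ℤ_(2)` (cell `pub-zeta5`, seat ct-1 g42)

HONEST FRAMING: systematic search; no irrationality claim unless certified.  INSTRUMENT identities/valuations about the
Laurent coefficients `laurent A B 0 n K d = [T^d](T^A·R_n(−K+T))` (`BrickLaurent`) of the centre-free brick kernel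
`R_n = brickKernel A B 0 n`; nothing about `ζ(5)`/`ζ(3)`; no `γ`/record statement; records in print UNMOVED; NOTHING IS
DISCHARGED (net named-fact debt 0).

WHY: at `p = 2` the rows split into `2N` — even poles `2K` handled by (B1) (`BrickLaurent.cell_frobenius`,
`BrickFrobeniusAllPrimes.cell_frobenius_two`), odd poles = holes (`BrickHoleCellsAllPrimes`) — and `2N+1`, where BOTH parities
of poles map to the row `N` (no holes).  The companion file `BrickFrobeniusTwoOddRow` treats the ODD poles; here the EVEN
poles, from `BrickKernelFrobeniusTwo.brickKernel_two_odd_row_even` (`2^{A−B}·R_{2N+1}(2t) = Ψ′_N(t)·(t+2N+1)^B·R_N(t)`), turned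
into the cell identity the way `BrickLaurent` turns `brickKernel_frobenius` into (B1), with
`W′(T) := Ψ′_N(−K+T)·(T−K+2N+1)^B = N_W′(T)/D_W′(T)` written out as polynomials
(`N_W′ = D^{A−2B}·[∏_{i≤N}((−2K−2i−1)+2T)·∏_{1≤i≤N}((2N+2i+1−2K)+2T)]^B·(T+(2N+1−K))^B`, `D_W′ = [∏_{i≤N}((2i+1−2K)+2T)]^A`,
`D = ∏_{i≤N}(2i+1)`):

* `topFun_two_odd_row_odd` — regular parts: `g^{(2N+1)}_{2K+1}(2t−1) = 2^B·Ψ_N(t)·(t−N−1)^B·g^{(N)}_K(t)` (`t ≠ −K`);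
* `eval_psiDen_ne_zero` — `D_W(T₀) ≠ 0` at every `T₀ ∈ ℤ` (odd factors); `psi_eval` — `N_W(T)/D_W(T) = Ψ_N(−K+T)·(T−K−N−1)^B`;
* `frobenius_poly_two_odd_odd` — the polynomial identity `L_N·D_W·tD = 2^B·L_D·N_W·tN`;
* **`laurentSeries_two_odd_odd`** — `rescale₂(F^{(2N+1)}_{2K+1}) = C(2^B)·(N_W/D_W)·F^{(N)}_K` in `ℚ⟦T⟧`;
* **`laurent_two_odd_odd`** — `2^d·laurent(2N+1, 2K+1, d) = 2^B·Σ_{(m,e) ∈ antidiagonal d} w_m·laurent(N, K, e)`,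
  `w_m = [T^m](N_W/D_W)`; **`cell_two_odd_odd`** (cells `s`, `d = A − s`);
* **`isSlopeInt_psiSeries`** — `w_m ∈ ℤ_(2)` for every `m` (`isSlopeInt_psiNum`, `isSlopeInt_psiDen`,
  `padicValuation_constantCoeff_psiDen`: `D_W(0)` odd; `BrickPhiAllPrimes.isSlopeInt_coe_*`, `BrickPhiCoeff.isSlopeInt_inv`), and **`padicValuation_pow_mul_laurent_two_odd_odd`**: the one-step bound
  `v₂(2^d·laurent(2N+1,2K,d)) ≤ 2^{−B}·max_e v₂(laurent(N,K,e))` (`padicValuation_pow_mul_laurent_two_odd_even`).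
  saving that `φ_m ∈ p^mℤ_(p)` supplies on the rows `np`.

Theorems only (0 `def`: `N_W′`, `D_W′` are written out in each statement); tree vocabulary; nothing restated.
-/

namespace Summit.KontsevichZagierPeriods.Zeta5Search.BrickFrobeniusTwoOddRowEven

open Finset Nat Polynomial WithZero
open Summit.KontsevichZagierPeriods.Zeta5Search.BrickKernelFrobenius (brickKernel)
open Summit.KontsevichZagierPeriods.Zeta5Search.BrickTopCoefficient (topFun brickKernel_mul_pow)
open Summit.KontsevichZagierPeriods.Zeta5Search.BrickKernelFrobeniusTwo (brickKernel_two_odd_row_even)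
open Summit.KontsevichZagierPeriods.Zeta5Search.BrickFrobeniusTwoOddRow (odd_add_two_mul_ne_zero isSlopeInt_two_linear)
open Summit.KontsevichZagierPeriods.Zeta5Search.BrickLaurent (expandAt laurentSeries laurent cell kerNum kerDenErase
  topFun_eq_div eval_kerDenErase_neg_ne_zero coe_comp_C_mul_X rescale_inv constantCoeff_coe_taylor)
open Summit.KontsevichZagierPeriods.Zeta5Search.ScaledSeries (IsSlopeInt isSlopeInt_mul isSlopeInt_C isSlopeInt_mono_left)
open Summit.KontsevichZagierPeriods.Zeta5Search.BrickPhiCoeff (isSlopeInt_coe_map_int isSlopeInt_inv)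
open Summit.KontsevichZagierPeriods.Zeta5Search.BrickPhiAllPrimes (isSlopeInt_coe_C_add_C_mul_X isSlopeInt_coe_prod
  isSlopeInt_coe_pow)

noncomputable section

/-! ## The regular parts -/

/-- **Regular parts on an odd row, even pole**: for `2B ≤ A`, `K ≤ N`, `t ≠ −K`:
`g^{(2N+1)}_{2K}(2t) = 2^B·Ψ′_N(t)·(t+2N+1)^B·g^{(N)}_K(t)` (`topFun`; from `brickKernel_two_odd_row_even` and
`2t + 2K = 2(t+K)`). -/
theorem topFun_two_odd_row_even {A B : ℕ} (hAB : 2 * B ≤ A) {N K : ℕ} (hK : K ≤ N) {t : ℚ} (ht : t + K ≠ 0) :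
    topFun A B 0 (2 * N + 1) (2 * K) (2 * t) =
      (2 : ℚ) ^ B * ((∏ i ∈ range (N + 1), (2 * (i : ℚ) + 1)) ^ (A - 2 * B) *
          ((∏ i ∈ range (N + 1), (2 * t - 2 * i - 1)) * ∏ i ∈ Icc 1 N, (2 * t + 2 * N + 2 * i + 1)) ^ B /
          (∏ i ∈ range (N + 1), (2 * t + 2 * i + 1)) ^ A * (t + 2 * N + 1) ^ B) * topFun A B 0 N K t := by
  have h1 : (2 * t) + ((2 * K : ℕ) : ℚ) ≠ 0 := by
    push_cast; intro h; apply ht; linarith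
  rw [← brickKernel_mul_pow A B 0 (by omega : 2 * K ≤ 2 * N + 1) h1, ← brickKernel_mul_pow A B 0 hK ht]
  have hO := brickKernel_two_odd_row_even (K := ℚ) hAB two_ne_zero N t
  have e : (2 * t + ((2 * K : ℕ) : ℚ)) ^ A = (2 : ℚ) ^ (A - B) * (2 : ℚ) ^ B * (t + K) ^ A := by
    rw [← pow_add, Nat.sub_add_cancel (by omega : B ≤ A), ← mul_pow]; congr 1; push_cast; ring
  rw [e, show brickKernel A B 0 (2 * N + 1) (2 * t) * ((2 : ℚ) ^ (A - B) * (2 : ℚ) ^ B * (t + K) ^ A) =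
      ((2 : ℚ) ^ (A - B) * brickKernel A B 0 (2 * N + 1) (2 * t)) * ((2 : ℚ) ^ B * (t + K) ^ A) by ring, hO]
  ring

/-! ## `W′(T) = Ψ′_N(−K+T)·(T−K+2N+1)^B` as a quotient of polynomials -/

section poly

variable (A B N K : ℕ)

/-- `D_W′(T₀) ≠ 0` for every integer `T₀`: all factors `(2i+1−2K) + 2T₀` are odd. -/
theorem eval_psiDen'_ne_zero (T₀ : ℤ) :
    ((∏ i ∈ range (N + 1), (C (2 * (i : ℚ) + 1 - 2 * K) + C (2 : ℚ) * X)) ^ A).eval (T₀ : ℚ) ≠ 0 := by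
  rw [eval_pow, eval_prod]
  refine pow_ne_zero _ (Finset.prod_ne_zero_iff.2 fun i _ => ?_)
  rw [eval_add, eval_mul, eval_C, eval_C, eval_X]
  have h := odd_add_two_mul_ne_zero (c := 2 * (i : ℤ) + 1 - 2 * K) ⟨(i : ℤ) - K, by ring⟩ T₀
  push_cast at h
  exact h

/-- **`N_W′(T)/D_W′(T) = Ψ′_N(−K+T)·(T−K+2N+1)^B`** for every `T`. -/
theorem psi'_eval (T : ℚ) :
    (C ((∏ i ∈ range (N + 1), (2 * (i : ℚ) + 1)) ^ (A - 2 * B)) *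
        ((∏ i ∈ range (N + 1), (C (-(2 * (K : ℚ)) - 2 * i - 1) + C (2 : ℚ) * X)) *
          ∏ i ∈ Icc 1 N, (C (-(2 * (K : ℚ)) + 2 * N + 2 * i + 1) + C (2 : ℚ) * X)) ^ B *
        (X + C (((2 * N + 1 : ℕ) : ℚ) - K)) ^ B).eval T /
      ((∏ i ∈ range (N + 1), (C (2 * (i : ℚ) + 1 - 2 * K) + C (2 : ℚ) * X)) ^ A).eval T =
    (∏ i ∈ range (N + 1), (2 * (i : ℚ) + 1)) ^ (A - 2 * B) *
        ((∏ i ∈ range (N + 1), (2 * (-(K : ℚ) + T) - 2 * i - 1)) * ∏ i ∈ Icc 1 N, (2 * (-(K : ℚ) + T) + 2 * N + 2 * i + 1)) ^ B /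
        (∏ i ∈ range (N + 1), (2 * (-(K : ℚ) + T) + 2 * i + 1)) ^ A * (-(K : ℚ) + T + 2 * N + 1) ^ B := by
  simp only [eval_mul, eval_pow, eval_prod, eval_add, eval_C, eval_X]
  have h1 : ∏ i ∈ range (N + 1), (-(2 * (K : ℚ)) - 2 * i - 1 + 2 * T) = ∏ i ∈ range (N + 1), (2 * (-(K : ℚ) + T) - 2 * i - 1) :=
    Finset.prod_congr rfl fun i _ => by ring
  have h2 : ∏ i ∈ Icc 1 N, (-(2 * (K : ℚ)) + 2 * N + 2 * i + 1 + 2 * T) =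
      ∏ i ∈ Icc 1 N, (2 * (-(K : ℚ) + T) + 2 * N + 2 * i + 1) :=
    Finset.prod_congr rfl fun i _ => by ring
  have h3 : ∏ i ∈ range (N + 1), (2 * (i : ℚ) + 1 - 2 * K + 2 * T) = ∏ i ∈ range (N + 1), (2 * (-(K : ℚ) + T) + 2 * i + 1) :=
    Finset.prod_congr rfl fun i _ => by ring
  rw [h1, h2, h3]
  push_cast
  ring

end poly

/-! ## The polynomial identity and (B1) on the odd row -/

section frobenius

variable {A B : ℕ} (hAB : 2 * B ≤ A) {N K : ℕ} (hK : K ≤ N)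
include hAB hK

/-- The polynomial identity behind the odd-row even-pole (B1): with `L_N = taylor_{−2K}(kerNum_{2N+1})(2T)`,
`L_D = taylor_{−2K}(kerDenErase_{2N+1,2K})(2T)`, `tN/tD = g_K(−K+T)`: `L_N·D_W′·tD = 2^B·L_D·N_W′·tN` in `ℚ[T]`. -/
theorem frobenius_poly_two_odd_even :
    (taylor (-((2 * K : ℕ) : ℚ)) (kerNum A B 0 (2 * N + 1))).comp (C (2 : ℚ) * X) *
        (∏ i ∈ range (N + 1), (C (2 * (i : ℚ) + 1 - 2 * K) + C (2 : ℚ) * X)) ^ A *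
        taylor (-(K : ℚ)) (kerDenErase A N K) =
      C ((2 : ℚ) ^ B) * (taylor (-((2 * K : ℕ) : ℚ)) (kerDenErase A (2 * N + 1) (2 * K))).comp (C (2 : ℚ) * X) *
        (C ((∏ i ∈ range (N + 1), (2 * (i : ℚ) + 1)) ^ (A - 2 * B)) *
          ((∏ i ∈ range (N + 1), (C (-(2 * (K : ℚ)) - 2 * i - 1) + C (2 : ℚ) * X)) *
            ∏ i ∈ Icc 1 N, (C (-(2 * (K : ℚ)) + 2 * N + 2 * i + 1) + C (2 : ℚ) * X)) ^ B *
          (X + C (((2 * N + 1 : ℕ) : ℚ) - K)) ^ B) *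
        taylor (-(K : ℚ)) (kerNum A B 0 N) := by
  set LD := (taylor (-((2 * K : ℕ) : ℚ)) (kerDenErase A (2 * N + 1) (2 * K))).comp (C (2 : ℚ) * X) with hLD
  set PD := (∏ i ∈ range (N + 1), (C (2 * (i : ℚ) + 1 - 2 * K) + C (2 : ℚ) * X)) ^ A with hPD
  set PN := C ((∏ i ∈ range (N + 1), (2 * (i : ℚ) + 1)) ^ (A - 2 * B)) *
      ((∏ i ∈ range (N + 1), (C (-(2 * (K : ℚ)) - 2 * i - 1) + C (2 : ℚ) * X)) *
        ∏ i ∈ Icc 1 N, (C (-(2 * (K : ℚ)) + 2 * N + 2 * i + 1) + C (2 : ℚ) * X)) ^ B *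
      (X + C (((2 * N + 1 : ℕ) : ℚ) - K)) ^ B with hPN
  set tD := taylor (-(K : ℚ)) (kerDenErase A N K) with htD
  clear_value LD PD PN tD
  have hG : X * (LD * PD * tD) ≠ 0 := by
    refine mul_ne_zero X_ne_zero fun h => ?_
    have h0 := congrArg (eval (0 : ℚ)) h
    rw [eval_mul, eval_mul, eval_zero] at h0
    rcases mul_eq_zero.1 h0 with h0 | h0
    · rcases mul_eq_zero.1 h0 with h0 | h0
      · rw [hLD, eval_comp, eval_mul, eval_C, eval_X, mul_zero, taylor_eval, zero_add] at h0
        exact eval_kerDenErase_neg_ne_zero A (2 * N + 1) (2 * K) h0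
      · rw [hPD] at h0
        have := eval_psiDen'_ne_zero A N K 0
        rw [Int.cast_zero] at this
        exact this h0
    · rw [htD, taylor_eval, zero_add] at h0
      exact eval_kerDenErase_neg_ne_zero A N K h0
  apply Polynomial.eq_of_infinite_eval_eq
  refine Set.Infinite.mono (s := {T : ℚ | ¬ (X * (LD * PD * tD)).IsRoot T}) (fun T hT => ?_)
    (Polynomial.finite_setOf_isRoot hG).infinite_compl
  have hT' : eval T (X * (LD * PD * tD)) ≠ 0 := hT
  rw [eval_mul, eval_mul, eval_mul, eval_X] at hT'
  have hT0 : T ≠ 0 := fun h => hT' (by rw [h, zero_mul])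
  have hT1 : eval T LD ≠ 0 := fun h => hT' (by rw [h, zero_mul, zero_mul, mul_zero])
  have hT2 : eval T PD ≠ 0 := fun h => hT' (by rw [h, mul_zero, zero_mul, mul_zero])
  have hT3 : eval T tD ≠ 0 := fun h => hT' (by rw [h, mul_zero, mul_zero])
  show eval T _ = eval T _
  have ht : -(K : ℚ) + T + K ≠ 0 := by rw [neg_add_cancel_comm]; exact hT0
  have hfun := topFun_two_odd_row_even hAB hK ht
  have e1 : topFun A B 0 (2 * N + 1) (2 * K) (2 * (-(K : ℚ) + T)) =
      ((taylor (-((2 * K : ℕ) : ℚ)) (kerNum A B 0 (2 * N + 1))).comp (C (2 : ℚ) * X)).eval T / LD.eval T := by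
    rw [topFun_eq_div, hLD, eval_comp, eval_comp, eval_mul, eval_C, eval_X, taylor_eval, taylor_eval]
    congr 2 <;> (push_cast; ring)
  have e2 := psi'_eval A B N K T
  rw [← hPN, ← hPD] at e2
  have e3 : topFun A B 0 N K (-(K : ℚ) + T) = (taylor (-(K : ℚ)) (kerNum A B 0 N)).eval T / tD.eval T := by
    rw [topFun_eq_div, htD, taylor_eval, taylor_eval, add_comm]
  rw [e1, ← e2, e3, div_eq_iff hT1] at hfun
  rw [eval_mul, eval_mul, hfun, eval_mul, eval_mul, eval_mul, eval_C]
  field_simp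

/-- **(B1) on the odd row, even pole, as power series**: `rescale₂(F^{(2N+1)}_{2K}) = C(2^B)·(N_W′/D_W′)·F^{(N)}_K` in
`ℚ⟦T⟧`, i.e. `F^{(2N+1)}_{2K}(2T) = 2^B·Ψ′_N(−K+T)·(T−K+2N+1)^B·F^{(N)}_K(T)`. -/
theorem laurentSeries_two_odd_even :
    PowerSeries.rescale (2 : ℚ) (laurentSeries A B 0 (2 * N + 1) (2 * K)) =
      PowerSeries.C ((2 : ℚ) ^ B) *
        expandAt 0 (C ((∏ i ∈ range (N + 1), (2 * (i : ℚ) + 1)) ^ (A - 2 * B)) *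
            ((∏ i ∈ range (N + 1), (C (-(2 * (K : ℚ)) - 2 * i - 1) + C (2 : ℚ) * X)) *
              ∏ i ∈ Icc 1 N, (C (-(2 * (K : ℚ)) + 2 * N + 2 * i + 1) + C (2 : ℚ) * X)) ^ B *
            (X + C (((2 * N + 1 : ℕ) : ℚ) - K)) ^ B)
          ((∏ i ∈ range (N + 1), (C (2 * (i : ℚ) + 1 - 2 * K) + C (2 : ℚ) * X)) ^ A) *
        laurentSeries A B 0 N K := by
  have hpoly := congrArg (fun P : ℚ[X] => (P : PowerSeries ℚ)) (frobenius_poly_two_odd_even hAB hK)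
  set PNp : ℚ[X] := C ((∏ i ∈ range (N + 1), (2 * (i : ℚ) + 1)) ^ (A - 2 * B)) *
      ((∏ i ∈ range (N + 1), (C (-(2 * (K : ℚ)) - 2 * i - 1) + C (2 : ℚ) * X)) *
        ∏ i ∈ Icc 1 N, (C (-(2 * (K : ℚ)) + 2 * N + 2 * i + 1) + C (2 : ℚ) * X)) ^ B *
      (X + C (((2 * N + 1 : ℕ) : ℚ) - K)) ^ B with hPNp
  set PDp : ℚ[X] := (∏ i ∈ range (N + 1), (C (2 * (i : ℚ) + 1 - 2 * K) + C (2 : ℚ) * X)) ^ A with hPDp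
  clear_value PNp PDp
  simp only [Polynomial.coe_mul, coe_comp_C_mul_X, Polynomial.coe_C] at hpoly
  set LN := PowerSeries.rescale (2 : ℚ) ((taylor (-((2 * K : ℕ) : ℚ)) (kerNum A B 0 (2 * N + 1)) : ℚ[X]) :
    PowerSeries ℚ) with hLN
  set LD := PowerSeries.rescale (2 : ℚ) ((taylor (-((2 * K : ℕ) : ℚ)) (kerDenErase A (2 * N + 1) (2 * K)) : ℚ[X]) :
    PowerSeries ℚ) with hLD
  set PN := ((PNp : ℚ[X]) : PowerSeries ℚ) with hPN
  set PD := ((PDp : ℚ[X]) : PowerSeries ℚ) with hPD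
  set tN := ((taylor (-(K : ℚ)) (kerNum A B 0 N) : ℚ[X]) : PowerSeries ℚ) with htN
  set tD := ((taylor (-(K : ℚ)) (kerDenErase A N K) : ℚ[X]) : PowerSeries ℚ) with htD
  have hLD0 : PowerSeries.constantCoeff LD ≠ 0 := by
    rw [hLD, ← PowerSeries.coeff_zero_eq_constantCoeff_apply, PowerSeries.coeff_rescale, pow_zero, one_mul,
      PowerSeries.coeff_zero_eq_constantCoeff_apply, constantCoeff_coe_taylor]
    exact eval_kerDenErase_neg_ne_zero A (2 * N + 1) (2 * K)
  have hPD0 : PowerSeries.constantCoeff PD ≠ 0 := by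
    rw [hPD, hPDp, Polynomial.constantCoeff_coe, coeff_zero_eq_eval_zero]
    have := eval_psiDen'_ne_zero A N K 0
    rwa [Int.cast_zero] at this
  have htD0 : PowerSeries.constantCoeff tD ≠ 0 := by
    rw [htD, constantCoeff_coe_taylor]; exact eval_kerDenErase_neg_ne_zero A N K
  have hL : PowerSeries.rescale (2 : ℚ) (laurentSeries A B 0 (2 * N + 1) (2 * K)) = LN * LD⁻¹ := by
    rw [laurentSeries, expandAt, map_mul, rescale_inv _ (by
      rw [constantCoeff_coe_taylor]; exact eval_kerDenErase_neg_ne_zero A (2 * N + 1) (2 * K))]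
  have hΨ : expandAt 0 PNp PDp = PN * PD⁻¹ := by
    rw [expandAt, taylor_zero, taylor_zero]
  have hR : laurentSeries A B 0 N K = tN * tD⁻¹ := rfl
  rw [hL, hΨ, hR]
  have hne : LD * PD * tD ≠ 0 := by
    refine mul_ne_zero (mul_ne_zero ?_ ?_) ?_ <;> intro h <;> [apply hLD0; apply hPD0; apply htD0] <;>
      rw [h, map_zero]
  apply mul_right_cancel₀ hne
  calc LN * LD⁻¹ * (LD * PD * tD) = LN * PD * tD * (LD⁻¹ * LD) := by ring
    _ = LN * PD * tD := by rw [PowerSeries.inv_mul_cancel _ hLD0, mul_one]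
    _ = PowerSeries.C ((2 : ℚ) ^ B) * LD * PN * tN := hpoly
    _ = PowerSeries.C ((2 : ℚ) ^ B) * LD * PN * tN * (PD⁻¹ * PD) * (tD⁻¹ * tD) := by
        rw [PowerSeries.inv_mul_cancel _ hPD0, PowerSeries.inv_mul_cancel _ htD0, mul_one, mul_one]
    _ = PowerSeries.C ((2 : ℚ) ^ B) * (PN * PD⁻¹) * (tN * tD⁻¹) * (LD * PD * tD) := by ring

/-- **(B1) on the odd row, even pole, at every depth**: for `2B ≤ A`, `K ≤ N`, every `d`:
`2^d·laurent(2N+1, 2K, d) = 2^B·Σ_{(m,e) ∈ antidiagonal d} w′_m·laurent(N, K, e)`, `w′_m = [T^m](N_W′/D_W′)`. -/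
theorem laurent_two_odd_even (d : ℕ) :
    (2 : ℚ) ^ d * laurent A B 0 (2 * N + 1) (2 * K) d =
      (2 : ℚ) ^ B * ∑ x ∈ antidiagonal d,
        PowerSeries.coeff x.1 (expandAt 0 (C ((∏ i ∈ range (N + 1), (2 * (i : ℚ) + 1)) ^ (A - 2 * B)) *
            ((∏ i ∈ range (N + 1), (C (-(2 * (K : ℚ)) - 2 * i - 1) + C (2 : ℚ) * X)) *
              ∏ i ∈ Icc 1 N, (C (-(2 * (K : ℚ)) + 2 * N + 2 * i + 1) + C (2 : ℚ) * X)) ^ B *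
            (X + C (((2 * N + 1 : ℕ) : ℚ) - K)) ^ B)
          ((∏ i ∈ range (N + 1), (C (2 * (i : ℚ) + 1 - 2 * K) + C (2 : ℚ) * X)) ^ A)) *
          laurent A B 0 N K x.2 := by
  have h := congrArg (PowerSeries.coeff d) (laurentSeries_two_odd_even hAB hK)
  rw [PowerSeries.coeff_rescale, mul_assoc, PowerSeries.coeff_C_mul, PowerSeries.coeff_mul] at h
  simpa only [laurent] using h

/-- **(B1) on the odd row, even pole, in cell indexing** (`1 ≤ s ≤ A`):
`2^{A−s}·c_{2K,s}(2N+1) = 2^B·Σ_{m=0}^{A−s} w′_m·c_{K,s+m}(N)`. -/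
theorem cell_two_odd_even (s : ℕ) :
    (2 : ℚ) ^ (A - s) * cell A B 0 (2 * N + 1) (2 * K) s =
      (2 : ℚ) ^ B * ∑ m ∈ range (A - s + 1),
        PowerSeries.coeff m (expandAt 0 (C ((∏ i ∈ range (N + 1), (2 * (i : ℚ) + 1)) ^ (A - 2 * B)) *
            ((∏ i ∈ range (N + 1), (C (-(2 * (K : ℚ)) - 2 * i - 1) + C (2 : ℚ) * X)) *
              ∏ i ∈ Icc 1 N, (C (-(2 * (K : ℚ)) + 2 * N + 2 * i + 1) + C (2 : ℚ) * X)) ^ B *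
            (X + C (((2 * N + 1 : ℕ) : ℚ) - K)) ^ B)
          ((∏ i ∈ range (N + 1), (C (2 * (i : ℚ) + 1 - 2 * K) + C (2 : ℚ) * X)) ^ A)) *
          cell A B 0 N K (s + m) := by
  rw [cell, laurent_two_odd_even hAB hK (A - s), Finset.Nat.sum_antidiagonal_eq_sum_range_succ_mk]
  congr 1
  refine Finset.sum_congr rfl fun m _ => ?_
  rw [cell, Nat.sub_add_eq]

end frobenius

/-! ## The multiplier series is `2`-integral -/

section arithmetic

/-- `N_W′ ∈ ℤ_(2)[T]`: the numerator of `W′` is `(0,0)`-integral as a power series. -/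
theorem isSlopeInt_psi'Num (A B N K : ℕ) :
    IsSlopeInt 2 0 0 ((C ((∏ i ∈ range (N + 1), (2 * (i : ℚ) + 1)) ^ (A - 2 * B)) *
      ((∏ i ∈ range (N + 1), (C (-(2 * (K : ℚ)) - 2 * i - 1) + C (2 : ℚ) * X)) *
        ∏ i ∈ Icc 1 N, (C (-(2 * (K : ℚ)) + 2 * N + 2 * i + 1) + C (2 : ℚ) * X)) ^ B *
      (X + C (((2 * N + 1 : ℕ) : ℚ) - K)) ^ B : ℚ[X]) : PowerSeries ℚ) := by
  haveI : Fact (Nat.Prime 2) := ⟨Nat.prime_two⟩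
  rw [Polynomial.coe_mul, Polynomial.coe_mul]
  have h1 : IsSlopeInt 2 0 0 ((C ((∏ i ∈ range (N + 1), (2 * (i : ℚ) + 1)) ^ (A - 2 * B)) : ℚ[X]) : PowerSeries ℚ) := by
    have hc : ((((∏ i ∈ range (N + 1), (2 * (i : ℤ) + 1)) ^ (A - 2 * B) : ℤ)) : ℚ) =
        (∏ i ∈ range (N + 1), (2 * (i : ℚ) + 1)) ^ (A - 2 * B) := by
      rw [Int.cast_pow, Int.cast_prod]
      exact congrArg (· ^ (A - 2 * B)) (Finset.prod_congr rfl fun i _ => by push_cast; ring)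
    rw [Polynomial.coe_C, ← hc]
    refine isSlopeInt_C 0 ?_
    rw [exp_zero, Rat.padicValuation_cast]
    exact Int.padicValuation_le_one 2 _
  have h2 : IsSlopeInt 2 0 0 ((((∏ i ∈ range (N + 1), (C (-(2 * (K : ℚ)) - 2 * i - 1) + C (2 : ℚ) * X)) *
      ∏ i ∈ Icc 1 N, (C (-(2 * (K : ℚ)) + 2 * N + 2 * i + 1) + C (2 : ℚ) * X)) ^ B : ℚ[X]) : PowerSeries ℚ) := by
    refine isSlopeInt_coe_pow _ ?_ B
    rw [Polynomial.coe_mul]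
    have ha := isSlopeInt_coe_prod (p := 2) (range (N + 1)) (fun i => C (-(2 * (K : ℚ)) - 2 * i - 1) + C (2 : ℚ) * X)
      (w := 0) fun i _ => isSlopeInt_two_linear (-(2 * (K : ℤ)) - 2 * i - 1) (-(2 * (K : ℚ)) - 2 * i - 1) (by push_cast; ring)
    have hb := isSlopeInt_coe_prod (p := 2) (Icc 1 N)
      (fun i => C (-(2 * (K : ℚ)) + 2 * N + 2 * i + 1) + C (2 : ℚ) * X) (w := 0) fun i _ =>
        isSlopeInt_two_linear (-(2 * (K : ℤ)) + 2 * N + 2 * i + 1) (-(2 * (K : ℚ)) + 2 * N + 2 * i + 1)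
          (by push_cast; ring)
    have h := isSlopeInt_mul ha hb
    rwa [add_zero] at h
  have h3 : IsSlopeInt 2 0 0 (((X + C (((2 * N + 1 : ℕ) : ℚ) - K)) ^ B : ℚ[X]) : PowerSeries ℚ) := by
    have e : ((X + C (((2 * N + 1 : ℕ) : ℤ) - K)) ^ B).map (Int.castRingHom ℚ) = (X + C (((2 * N + 1 : ℕ) : ℚ) - K)) ^ B := by
      rw [Polynomial.map_pow, Polynomial.map_add, map_X, Polynomial.map_C, eq_intCast, Int.cast_sub, Int.cast_natCast,
        Int.cast_natCast]
    rw [← e]; exact isSlopeInt_coe_map_int _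
  have h := isSlopeInt_mul (isSlopeInt_mul h1 h2) h3
  rwa [add_zero, add_zero] at h

/-- `D_W′ ∈ ℤ_(2)[T]`. -/
theorem isSlopeInt_psi'Den (A N K : ℕ) :
    IsSlopeInt 2 0 0 (((∏ i ∈ range (N + 1), (C (2 * (i : ℚ) + 1 - 2 * K) + C (2 : ℚ) * X)) ^ A : ℚ[X]) :
      PowerSeries ℚ) := by
  haveI : Fact (Nat.Prime 2) := ⟨Nat.prime_two⟩
  refine isSlopeInt_coe_pow _ ?_ A
  exact isSlopeInt_coe_prod (p := 2) (range (N + 1)) (fun i => C (2 * (i : ℚ) + 1 - 2 * K) + C (2 : ℚ) * X) (w := 0)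
    fun i _ => isSlopeInt_two_linear (2 * (i : ℤ) + 1 - 2 * K) (2 * (i : ℚ) + 1 - 2 * K) (by push_cast; ring)

/-- `D_W′(0) = ∏_{i≤N}(2i+1−2K)^A` is a `2`-adic unit (every factor is odd). -/
theorem padicValuation_constantCoeff_psi'Den (A N K : ℕ) :
    @Rat.padicValuation 2 ⟨Nat.prime_two⟩ (PowerSeries.constantCoeff
      (((∏ i ∈ range (N + 1), (C (2 * (i : ℚ) + 1 - 2 * K) + C (2 : ℚ) * X)) ^ A : ℚ[X]) : PowerSeries ℚ)) = 1 := by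
  haveI : Fact (Nat.Prime 2) := ⟨Nat.prime_two⟩
  have hfac : ∀ i ∈ range (N + 1),
      Rat.padicValuation 2 ((C (2 * (i : ℚ) + 1 - 2 * K) + C (2 : ℚ) * X).eval 0) = 1 := fun i _ => by
    rw [eval_add, eval_mul, eval_C, eval_C, eval_X, mul_zero, add_zero,
      show (2 * (i : ℚ) + 1 - 2 * K) = ((2 * (i : ℤ) + 1 - 2 * K : ℤ) : ℚ) by push_cast; ring, Rat.padicValuation_cast,
      Int.padicValuation_eq_one_iff]
    rintro ⟨c, hc⟩
    push_cast at hc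
    omega
  rw [Polynomial.constantCoeff_coe, coeff_zero_eq_eval_zero, eval_pow, eval_prod, map_pow, map_prod,
    Finset.prod_eq_one hfac, one_pow]

/-- **`w′_m ∈ ℤ_(2)` for every `m`**: `W′ = N_W′/D_W′ ∈ ℤ_(2)⟦T⟧` (`N_W′`, `D_W′` `2`-integral, `D_W′(0)` odd;
`BrickPhiCoeff.isSlopeInt_inv`).  Finer (not needed here): the `Ψ′` part has slope `−1`; the polynomial factor
`(T+(2N+1−K))^B` carries the `(2N+1−K)^B` of the top-coefficient ratio. -/
theorem isSlopeInt_psi'Series (A B N K : ℕ) :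
    IsSlopeInt 2 0 0 (expandAt 0 (C ((∏ i ∈ range (N + 1), (2 * (i : ℚ) + 1)) ^ (A - 2 * B)) *
            ((∏ i ∈ range (N + 1), (C (-(2 * (K : ℚ)) - 2 * i - 1) + C (2 : ℚ) * X)) *
              ∏ i ∈ Icc 1 N, (C (-(2 * (K : ℚ)) + 2 * N + 2 * i + 1) + C (2 : ℚ) * X)) ^ B *
            (X + C (((2 * N + 1 : ℕ) : ℚ) - K)) ^ B)
          ((∏ i ∈ range (N + 1), (C (2 * (i : ℚ) + 1 - 2 * K) + C (2 : ℚ) * X)) ^ A)) := by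
  haveI : Fact (Nat.Prime 2) := ⟨Nat.prime_two⟩
  have h := isSlopeInt_mul (isSlopeInt_psi'Num A B N K)
    (isSlopeInt_inv (isSlopeInt_psi'Den A N K) (padicValuation_constantCoeff_psi'Den A N K))
  rw [add_zero] at h
  rw [expandAt, taylor_zero, taylor_zero]
  exact h

/-- **The one-step descent bound on an odd row, even pole**: for `2B ≤ A`, `K ≤ N` and any bound `b` with
`v₂(laurent(N, K, e)) ≤ b` for all `e ≤ d`:  `v₂(2^d·laurent(2N+1, 2K, d)) ≤ 2^{−B}·b`. -/
theorem padicValuation_pow_mul_laurent_two_odd_even {A B : ℕ} (hAB : 2 * B ≤ A) {N K : ℕ} (hK : K ≤ N) (d : ℕ)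
    {b : ℤᵐ⁰} (hb : ∀ e, e ≤ d → @Rat.padicValuation 2 ⟨Nat.prime_two⟩ (laurent A B 0 N K e) ≤ b) :
    @Rat.padicValuation 2 ⟨Nat.prime_two⟩ ((2 : ℚ) ^ d * laurent A B 0 (2 * N + 1) (2 * K) d) ≤
      exp (-(B : ℤ)) * b := by
  haveI : Fact (Nat.Prime 2) := ⟨Nat.prime_two⟩
  have hw := isSlopeInt_psi'Series A B N K
  rw [laurent_two_odd_even hAB hK d, map_mul, map_pow, show (2 : ℚ) = ((2 : ℕ) : ℚ) by norm_num, Rat.padicValuation_self,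
    ← exp_nsmul, nsmul_eq_mul, mul_neg_one]
  refine mul_le_mul' le_rfl (Valuation.map_sum_le _ fun x hx => ?_)
  rw [map_mul]
  have h1 := hw x.1
  rw [zero_mul, zero_add, exp_zero] at h1
  calc _ ≤ 1 * b := mul_le_mul' h1 (hb x.2 (by have := mem_antidiagonal.1 hx; omega))
    _ = b := one_mul b

end arithmetic

end

end Summit.KontsevichZagierPeriods.Zeta5Search.BrickFrobeniusTwoOddRowEven
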